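import Summits.BirchSwinnertonDyer.BirchSwinnertonDyer.Theorems.GenusKolyvaginAtTwoGenusPrimitiveSupplyAtTwoPosDiscShallowKFourPosSelmerProfile
import Summits.BirchSwinnertonDyer.BirchSwinnertonDyer.Theorems.AdditiveKolyvaginRoadBottomRankOneAdditiveClassOfPoint
import Literature.NumberTheory.EllipticCurves.LeadingTermProofs
import HarnessLib

/-!
# Route `GenusKolyvaginAtTwo`, cruxes K₄⁺ `K4Pos` (stmt-BirchSwinnertonDyer-31469) / K₄ `K4Neg` (31526) — THE SELMER PROFILE OVER `K`:
# on the cut cells (mod Q2) `#Sel_(2^k)(E_K/K) = 2^k · 4^(min k e)` for EVERY `k`, with the SAME `e` as over `ℚ` (`#Sel_(2^k)(E/ℚ) = 4^(min k e)`)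

Width seat `bsd-line-gk2-p5` g37 (cell `bsd-f1-sign2`), `--supports stmt-BirchSwinnertonDyer-31469 --as helper`; K-side companion of this seat's
`…KFourPosSelmerProfile` (p775150), over gk2-p4 g29's two-sided one-block structure `Ш(E_K/K)[2^∞] ≃ Ш(E/ℚ)[2^∞] ≃ (ℤ/2^e)²`
(`ShaCores.exists_addEquiv_shaPrimary_of_kFourPos_cut` / `…_of_kFourNeg_cut`, mod Q2).  THEOREMS ONLY (no definition, no named fact, no `sorry`);
standard axioms.  **BSD is NOT proved by this file; K4Pos / K4Neg are NOT proved; nothing is closed.**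

* §1 `natCard_selmerGroup_two_pow_eq_of_rank_of_addEquiv` — ANY number field: `rank E(F) = r`, `E(F)[2] = 0`, `Ш(E/F)[2^∞] ≃ (ℤ/2^e)²` ⟹
  **`#Sel_(2^k)(E/F) = 2^(k·r) · 4^(min k e)`** (AEC X.4.2 count).
* §2 `exists_selmerProfile_pair_of_kFourPos_cut` — the K₄⁺ cut cell (gk2-p4's frame VERBATIM, mod Q2): `rank E(K) = 1` (Heegner point of infinite
  order + gk2-p3's frame bound), `E(K)[2] = 0`, and ONE `e` (`1 ≤ e ≤ M₀`) with **`#Sel_(2^k)(E_K/K) = 2^k · 4^(min k e)` and `#Sel_(2^k)(E/ℚ) = 4^(min k e)`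
  for every `k`** — at `k = 1`: `#Sel₂(E_K) = 8`, `#Sel₂(E/ℚ) = 4` (the cell); at `k = 2`: `#Sel₄(E_K) ∈ {16, 64}`, K₄⁺ ⟺ `64` ⟺ `#Sel₄(E/ℚ) = 16`.
* §3 `exists_selmerProfile_pair_of_kFourNeg_cut` — the K₄ cut cell alike.
INSTRUMENT: a `2^k`-descent over `K` carries the SAME information as over `ℚ` (one factor `2^k` for the Heegner line); the ℚ-side count is the cheaper
test.  BSD is NOT proved by any of this.

References: [SilvermanAEC2009] Thm. X.4.2; [GrossLMS1991] §5 Prop. 5.3; [Kramer1981] Thm. 1; [Cassels1962ArithmeticIV] §1; [McCallumLMS1991] §5 Cor. 5.6.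
-/

set_option autoImplicit false
-- the Theorems namespace of this sub repeats the summit name by design (D-0017 nested layout)
set_option linter.dupNamespace false

noncomputable section

open scoped Classical
open scoped AddSubgroup

namespace Summit.BirchSwinnertonDyer.BirchSwinnertonDyer.Theorems.GenusExact.PlusDescent

open WeierstrassCurve NumberField IsDedekindDomain Field Literature.NumberTheory.EllipticCurves
  Literature.NumberTheory.GaloisRepresentations Literature.NumberTheory.EllipticCurves.ModularForms AddSubgroup
  Literature.NumberTheory.EllipticCurves.RingClassField
open Summit.BirchSwinnertonDyer.BirchSwinnertonDyer.Theses.GenusKolyvaginAtTwo (KolyvaginRelationAtTwo)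
open Summit.BirchSwinnertonDyer.BirchSwinnertonDyer.Theorems.GenusExact.ShaCores
  (mordellWeilRank_eq_zero_and_finite_shaPrimary_rat_of_cut exists_addEquiv_shaPrimary_of_kFourPos_cut exists_addEquiv_shaPrimary_of_kFourNeg_cut)

/-! ## §1 `#Sel_(2^k)(E/F) = 2^(k·r) · 4^(min k e)` from `rank E(F) = r`, `E(F)[2] = 0`, `Ш(E/F)[2^∞] ≃ (ℤ/2^e)²` -/

section Descent

variable {F : Type} [Field F] [NumberField F] (V : WeierstrassCurve F) [V.IsElliptic]

/-- **THE SELMER PROFILE OF A ONE-BLOCK CURVE OF RANK `r`**: `rank E(F) = r`, `E(F)[2] = 0`, `Ш(E/F)[2^∞] ≃ ℤ/2^e × ℤ/2^e` ⟹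
`#Sel_(2^k)(E/F) = 2^(k·r) · 4^(min k e)` (AEC X.4.2 count `#Sel_(n) = n^rk · #E(F)[n] · #Ш[n]`, `#E(F)[2^k] = 1`, `#Ш[2^k] = 4^(min k e)`).
[cite: SilvermanAEC2009, Thm. X.4.2 (a), (b)] [cite: Fuchs1970, Ch. I §1, §8] -/
theorem natCard_selmerGroup_two_pow_eq_of_rank_of_addEquiv {r : ℕ} (hrk : V.mordellWeilRank = r)
    (h2 : ∀ P : V.toAffine.Point, (2 : ℤ) • P = 0 → P = 0) {e : ℕ}
    (eX : AddCommGroup.primaryComponent (↥V.sha) 2 ≃+ ZMod (2 ^ e) × ZMod (2 ^ e)) (k : ℕ) :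
    Nat.card (selmerGroup V ((2 ^ k : ℕ) : ℤ)) = 2 ^ (k * r) * 4 ^ min k e := by
  haveI : Fact (Nat.Prime 2) := ⟨Nat.prime_two⟩
  have h := V.pow_mordellWeilRank_mul_natCard_torsionBy_mul_natCard_shaTorsionBy_eq (n := 2 ^ k) (pow_ne_zero k two_ne_zero)
  rw [hrk, natCard_torsionBy_point_two_pow_eq_one V h2 k, mul_one,
    GenusExact.CasselsTateNumberField.natCard_sha_torsionBy_pow_eq_primaryComponent V 2 k, natCard_torsionBy_congr_natCast eX (2 ^ k),
    natCard_torsionBy_zmod_sq_two_pow, ← pow_mul] at h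
  exact h.symm

end Descent

/-! ## §2 The K₄⁺ cut cell: the pair profile over `K` and over `ℚ` -/

section KFourPos

variable (W : WeierstrassCurve ℚ) [W.IsElliptic] [W.IsGloballyMinimal] [NeZero (W.conductorNorm ℤ)]
variable (K : Type) [Field K] [NumberField K]

/-- **THE PAIR'S SELMER PROFILE ON THE K₄⁺ CUT CELL, mod Q2 (no GZK, no witness).**  On gk2-p4 g29's K₄⁺ cut frame VERBATIM: `rank E(K) = 1`,
`E(K)[2] = 0`, and ONE `e` with `1 ≤ e ≤ M₀`, `#Ш(E_K/K)[2^∞] = #Ш(E/ℚ)[2^∞] = 4^e`, **`#Sel_(2^k)(E_K/K) = 2^k · 4^(min k e)`** and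
**`#Sel_(2^k)(E/ℚ) = 4^(min k e)`** for EVERY `k`.  (`rank E(K) = 1`: the Heegner point is of infinite order and gk2-p3's `exists_frame_of_cut` bounds
the rank by `1`; structures: gk2-p4's `exists_addEquiv_shaPrimary_of_kFourPos_cut`; the ℚ-side count binders: `mordellWeilRank_eq_zero_and_finite_shaPrimary_rat_of_cut`.)
K₄⁺ at `E` ⟺ `e = M₀`.  BSD is NOT proved by this. [cite: SilvermanAEC2009, Thm. X.4.2] [cite: GrossLMS1991, §5 Prop. 5.3] [cite: Kramer1981, Thm. 1]
[cite: Cassels1962ArithmeticIV, §1] -/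
theorem exists_selmerProfile_pair_of_kFourPos_cut (hQ2 : KolyvaginRelationAtTwo) (hcm : ¬ W.HasCM)
    (hT : Odd W.tamagawaProduct) (v : HeightOneSpectrum (𝓞 ℚ)) (h2v : ((2 : ℕ) : 𝓞 ℚ) ∉ v.asIdeal)
    (hNv : ((W.conductorNorm ℤ : ℕ) : 𝓞 ℚ) ∈ v.asIdeal) (hmult : W.HasMultiplicativeReductionAt v) (hpos : 0 < W.Δ)
    (hIQ : IsImaginaryQuadratic K) (hodd : Odd (NumberField.discr K))
    (h3 : NumberField.discr K ≠ -3) (hHe : SatisfiesHeegnerHypothesis (W.conductorNorm ℤ) K)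
    (hsq1 : ¬ IsSquare ((NumberField.discr K : ℚ) * -|W.Δ|)) (hsq2 : ¬ IsSquare ((NumberField.discr K : ℚ) * (-(2 * |W.Δ|))))
    (hρ : ∀ n : ℕ, 0 < n → W.HasSurjectiveModNGaloisRep ((2 : ℤ) ^ n))
    (Dt : ModularParametrizationData W (W.conductorNorm ℤ)) (β : ℤ) (ι : K →+* ℂ) (d₁ : KolyvaginHeegnerData Dt β ι 1)
    (hy : ¬ IsOfFinAddOrder d₁.derivedPoint) (M₀ : ℕ)
    (hdiv : ∃ Q : (W.baseChange (ringClassField K ι 1)).toAffine.Point, ((2 ^ M₀ : ℕ) : ℤ) • Q = d₁.derivedPoint)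
    (hndiv : ¬ ∃ Q : (W.baseChange (ringClassField K ι 1)).toAffine.Point, ((2 ^ (M₀ + 1) : ℕ) : ℤ) • Q = d₁.derivedPoint)
    (Wd : WeierstrassCurve ℚ) [Wd.IsElliptic] (Cd : VariableChange ℚ) (hCd : Cd • W.quadraticTwist (discr K : ℚ) = Wd)
    (hSel : Nat.card (Wd.selmerGroup 2) = 2) (hDEF : padicValNat 2 Wd.tamagawaProduct = 0)
    (h4 : Nat.card (W.selmerGroup 2) = 4 ∧ ∃ c ∈ (W.kummerSelmerStructure ((2 : ℕ) : ℤ)).selmerGroup,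
      galoisCohomology.localization (W.torsionGaloisModule ((2 : ℕ) : ℤ)) (Sum.inl Rat.infinitePlace) 1 c ≠ 0)
    (hr0 : W.analyticRank = 0) (h2K : ((Ideal.span {(2 : ℤ)}).primesOver (𝓞 K)).ncard = 2) {σ₀ : K ≃ₐ[ℚ] K} (hσ₀ : σ₀ ≠ 1) :
    (W.baseChange K).mordellWeilRank = 1 ∧ (∀ P : (W.baseChange K).toAffine.Point, (2 : ℤ) • P = 0 → P = 0) ∧
    ∃ e : ℕ, 1 ≤ e ∧ e ≤ M₀ ∧
      Nat.card (AddCommGroup.primaryComponent (↥(W.baseChange K).sha) 2) = 4 ^ e ∧ Nat.card (AddCommGroup.primaryComponent (↥W.sha) 2) = 4 ^ e ∧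
      (∀ k : ℕ, Nat.card (selmerGroup (W.baseChange K) ((2 ^ k : ℕ) : ℤ)) = 2 ^ k * 4 ^ min k e) ∧
      ∀ k : ℕ, Nat.card (W.selmerGroup ((2 ^ k : ℕ) : ℤ)) = 4 ^ min k e := by
  haveI : Fact (Nat.Prime 2) := ⟨Nat.prime_two⟩
  haveI hell : (W.baseChange K).IsElliptic := inferInstanceAs ((W.map (algebraMap ℚ K)).IsElliptic)
  have hs2 : W.HasSurjectiveModNGaloisRep 2 := by simpa using hρ 1 one_pos
  have hw : W.rootNumber = 1 :=
    (Literature.Barriers.BirchSwinnertonDyer.even_analyticRank_iff_of_isNewformOf_conductorLevel Dt.isNewformOf).mp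
      (by rw [hr0]; exact Even.zero)
  have hWd : ∃ C : VariableChange ℚ, C • W.quadraticTwist (discr K : ℚ) = Wd := ⟨Cd, hCd⟩
  obtain ⟨hrk0, -⟩ := mordellWeilRank_eq_zero_and_finite_shaPrimary_rat_of_cut W K hQ2 hcm hT v h2v hNv hmult hIQ hodd h3 hHe hsq1 hsq2 hρ Dt β
    ι d₁ M₀ hndiv hw
  -- the K-side frame: `E(K)[2] = 0`, `rank E(K) ≤ 1`
  obtain ⟨h2tors, hrkle, -, -⟩ := exists_frame_of_cut W K hIQ hHe hs2 hσ₀ Dt β ι d₁ hy M₀ hndiv hw hrk0 Wd hWd hSel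
  -- `rank E(K) ≥ 1`: the Heegner point under `P(1)` has infinite order
  obtain ⟨Ph, -, hPhmap⟩ := AdditiveKoly.exists_isHeegnerPoint_map_eq_derivedPoint_one (W := W) (K := K) (Dt := Dt) (β := β) (ι := ι)
    hIQ hHe d₁
  have hPhnt : ¬ IsOfFinAddOrder Ph := fun h ↦ hy (by rw [← hPhmap]; exact AddMonoidHom.isOfFinAddOrder _ h)
  haveI : Module.Finite ℤ (W.baseChange K).toAffine.Point := (W.baseChange K).module_finite_point_holds
  have hrk1 : (W.baseChange K).mordellWeilRank = 1 :=
    le_antisymm hrkle (one_le_mordellWeilRank_of_not_isOfFinAddOrder (W.baseChange K) inferInstance hPhnt)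
  -- the ℚ-side `E(ℚ)[2] = 0` (`convert` bridges the decidable-equality instance on `E(ℚ)`)
  have h2t := forall_eq_zero_of_two_zsmul_eq_zero_of_natCard_torsionBy_two_eq_one W
    (by convert natCard_torsionBy_point_two_eq_one_of_hasSurjectiveModNGaloisRep_two W hs2)
  obtain ⟨e, he1, heM, ⟨eX⟩, ⟨eY⟩, hXe, hYe⟩ := exists_addEquiv_shaPrimary_of_kFourPos_cut W K hQ2 hcm hT v h2v hNv hmult hpos hIQ hodd h3 hHe
    hsq1 hsq2 hρ Dt β ι d₁ hy M₀ hdiv hndiv Wd Cd hCd hSel hDEF h4 hr0 h2K hσ₀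
  refine ⟨hrk1, h2tors, e, he1, heM, hXe, hYe, fun k ↦ ?_, fun k ↦ ?_⟩
  · rw [natCard_selmerGroup_two_pow_eq_of_rank_of_addEquiv (W.baseChange K) hrk1 h2tors eX k, mul_one]
  · exact natCard_selmerGroup_two_pow_eq_pow_min_of_addEquiv W hrk0 h2t eY k

end KFourPos

/-! ## §3 The K₄ cut cell (Δ < 0): the pair profile -/

section KFourNeg

variable (W : WeierstrassCurve ℚ) [W.IsElliptic] [W.IsGloballyMinimal] [NeZero (W.conductorNorm ℤ)]
variable (K : Type) [Field K] [NumberField K]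

/-- **THE PAIR'S SELMER PROFILE ON THE K₄ CUT CELL (Δ < 0), mod Q2** — gk2-p4 g29's K₄ cut frame VERBATIM (`exists_addEquiv_shaPrimary_of_kFourNeg_cut`):
`rank E(K) = 1`, `E(K)[2] = 0`, and ONE `e` (`1 ≤ e ≤ M₀`) with `#Ш(E_K/K)[2^∞] = #Ш(E/ℚ)[2^∞] = 4^e`, **`#Sel_(2^k)(E_K/K) = 2^k · 4^(min k e)`**,
**`#Sel_(2^k)(E/ℚ) = 4^(min k e)`** for every `k`.  K₄ at `E` ⟺ `e = M₀`.  BSD is NOT proved by this. [cite: SilvermanAEC2009, Thm. X.4.2]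
[cite: GrossLMS1991, §5 Prop. 5.3] [cite: Kramer1981, Thm. 1] [cite: Cassels1962ArithmeticIV, §1] -/
theorem exists_selmerProfile_pair_of_kFourNeg_cut (hQ2 : KolyvaginRelationAtTwo) (hcm : ¬ W.HasCM)
    (hT : Odd W.tamagawaProduct) (v : HeightOneSpectrum (𝓞 ℚ)) (h2v : ((2 : ℕ) : 𝓞 ℚ) ∉ v.asIdeal)
    (hNv : ((W.conductorNorm ℤ : ℕ) : 𝓞 ℚ) ∈ v.asIdeal) (hmult : W.HasMultiplicativeReductionAt v) (hΔ : W.Δ < 0)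
    (hIQ : IsImaginaryQuadratic K) (hodd : Odd (NumberField.discr K))
    (h3 : NumberField.discr K ≠ -3) (hHe : SatisfiesHeegnerHypothesis (W.conductorNorm ℤ) K)
    (hsq1 : ¬ IsSquare ((NumberField.discr K : ℚ) * -|W.Δ|)) (hsq2 : ¬ IsSquare ((NumberField.discr K : ℚ) * (-(2 * |W.Δ|))))
    (hρ : ∀ n : ℕ, 0 < n → W.HasSurjectiveModNGaloisRep ((2 : ℤ) ^ n))
    (Dt : ModularParametrizationData W (W.conductorNorm ℤ)) (β : ℤ) (ι : K →+* ℂ) (d₁ : KolyvaginHeegnerData Dt β ι 1)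
    (hy : ¬ IsOfFinAddOrder d₁.derivedPoint) (M₀ : ℕ)
    (hdiv : ∃ Q : (W.baseChange (ringClassField K ι 1)).toAffine.Point, ((2 ^ M₀ : ℕ) : ℤ) • Q = d₁.derivedPoint)
    (hndiv : ¬ ∃ Q : (W.baseChange (ringClassField K ι 1)).toAffine.Point, ((2 ^ (M₀ + 1) : ℕ) : ℤ) • Q = d₁.derivedPoint)
    (Wd : WeierstrassCurve ℚ) [Wd.IsElliptic] (hWd : ∃ C : VariableChange ℚ, C • W.quadraticTwist (discr K : ℚ) = Wd)
    (hSel : Nat.card (Wd.selmerGroup 2) = 2) (hDEF : padicValNat 2 Wd.tamagawaProduct ≤ 1)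
    (h4 : Nat.card (W.selmerGroup 2) = 4) (hr0 : W.analyticRank = 0)
    (h2K : ((Ideal.span {(2 : ℤ)}).primesOver (𝓞 K)).ncard = 2) {ℓ₀ : ℕ} [Fact ℓ₀.Prime] (hd : discr K = -(ℓ₀ : ℤ))
    {σ₀ : K ≃ₐ[ℚ] K} (hσ₀ : σ₀ ≠ 1) :
    (W.baseChange K).mordellWeilRank = 1 ∧ (∀ P : (W.baseChange K).toAffine.Point, (2 : ℤ) • P = 0 → P = 0) ∧
    ∃ e : ℕ, 1 ≤ e ∧ e ≤ M₀ ∧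
      Nat.card (AddCommGroup.primaryComponent (↥(W.baseChange K).sha) 2) = 4 ^ e ∧ Nat.card (AddCommGroup.primaryComponent (↥W.sha) 2) = 4 ^ e ∧
      (∀ k : ℕ, Nat.card (selmerGroup (W.baseChange K) ((2 ^ k : ℕ) : ℤ)) = 2 ^ k * 4 ^ min k e) ∧
      ∀ k : ℕ, Nat.card (W.selmerGroup ((2 ^ k : ℕ) : ℤ)) = 4 ^ min k e := by
  haveI : Fact (Nat.Prime 2) := ⟨Nat.prime_two⟩
  haveI hell : (W.baseChange K).IsElliptic := inferInstanceAs ((W.map (algebraMap ℚ K)).IsElliptic)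
  have hs2 : W.HasSurjectiveModNGaloisRep 2 := by simpa using hρ 1 one_pos
  have hw : W.rootNumber = 1 :=
    (Literature.Barriers.BirchSwinnertonDyer.even_analyticRank_iff_of_isNewformOf_conductorLevel Dt.isNewformOf).mp
      (by rw [hr0]; exact Even.zero)
  obtain ⟨hrk0, -⟩ := mordellWeilRank_eq_zero_and_finite_shaPrimary_rat_of_cut W K hQ2 hcm hT v h2v hNv hmult hIQ hodd h3 hHe hsq1 hsq2 hρ Dt β
    ι d₁ M₀ hndiv hw
  obtain ⟨h2tors, hrkle, -, -⟩ := exists_frame_of_cut W K hIQ hHe hs2 hσ₀ Dt β ι d₁ hy M₀ hndiv hw hrk0 Wd hWd hSel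
  obtain ⟨Ph, -, hPhmap⟩ := AdditiveKoly.exists_isHeegnerPoint_map_eq_derivedPoint_one (W := W) (K := K) (Dt := Dt) (β := β) (ι := ι)
    hIQ hHe d₁
  have hPhnt : ¬ IsOfFinAddOrder Ph := fun h ↦ hy (by rw [← hPhmap]; exact AddMonoidHom.isOfFinAddOrder _ h)
  haveI : Module.Finite ℤ (W.baseChange K).toAffine.Point := (W.baseChange K).module_finite_point_holds
  have hrk1 : (W.baseChange K).mordellWeilRank = 1 :=
    le_antisymm hrkle (one_le_mordellWeilRank_of_not_isOfFinAddOrder (W.baseChange K) inferInstance hPhnt)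
  have h2t := forall_eq_zero_of_two_zsmul_eq_zero_of_natCard_torsionBy_two_eq_one W
    (by convert natCard_torsionBy_point_two_eq_one_of_hasSurjectiveModNGaloisRep_two W hs2)
  obtain ⟨e, he1, heM, ⟨eX⟩, ⟨eY⟩, hXe, hYe⟩ := exists_addEquiv_shaPrimary_of_kFourNeg_cut W K hQ2 hcm hT v h2v hNv hmult hΔ hIQ hodd h3 hHe hsq1
    hsq2 hρ Dt β ι d₁ hy M₀ hdiv hndiv Wd hWd hSel hDEF h4 hr0 h2K hd hσ₀
  refine ⟨hrk1, h2tors, e, he1, heM, hXe, hYe, fun k ↦ ?_, fun k ↦ ?_⟩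
  · rw [natCard_selmerGroup_two_pow_eq_of_rank_of_addEquiv (W.baseChange K) hrk1 h2tors eX k, mul_one]
  · exact natCard_selmerGroup_two_pow_eq_pow_min_of_addEquiv W hrk0 h2t eY k

end KFourNeg

end Summit.BirchSwinnertonDyer.BirchSwinnertonDyer.Theorems.GenusExact.PlusDescent

end
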